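import Mathlib
import HarnessLib
import Summits.ResolutionOfSingularities.ResolutionOfSingularities.Theorems.WildQuotientsWildQuotientResolutionS1aQhAbsRoot

/-!
# S1a — R4c brick (i): the QUASI-HOMOGENEOUS ROOT WITH TWO MOVING GENERATORS over an abstract node ring (`x₁ ↦ x₁ + x₀`, `x₂ ↦ x₂ + x₀`)

[OURS · L1 W4.5c · lead-1 g17; plan-1 RULINGS R-F15m (root rule `a = sh + max{w of moving generators}`), R-F15p/v (cusp R4c first), SPEC
`Lines/s1a_logminvertex-R4c-SPEC.md` §1 (1O): the cusp's level-1 root at the singular point is `(x₀ : 9, x₁ : 2, x₂ : 3; sh 6)` with BOTH tail coordinates moving;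
✓`…S1aQhAbsRoot` (one moving generator, `w 0 = w 1 + sh`) and ✓`…S1aSymRoot` (both moving, weights `(δ+1,1,1)`) are the two special cases. Ring level over an
ARBITRARY commutative ring `L` (polynomial base and its localisations alike), rows `τ fⱼ = fⱼ + f₀` (`j = 1, 2`), weights with `w 1 + sh ≤ w 0` and `w 0 = w 2 + sh`
(the heavier moving generator attains the bound — it carries the unit chain and puts `u₀′` in the residual)] — NOT statements of the manuscript; counted 0; AI-level
work, weaker than expert review. Crux stmt-ResolutionOfSingularities-17941 `CyclicQuotientFourfolds`, line `s1a-logminvertex` v13 (`stub_reachLowerInFX`).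

* `qs_admissible_one` — (a′)_sh (β = 1 product form) AND σ-adaptedness (one conjunction; `u₀′`/tail rows and fixedness are ✓`QhAbs.*` verbatim);
* rows in `R^w`: `coe_u'_zero_mul_s_pow`, `qs_sigmaR_u'_one_sub` (`σ_R u₁′ − u₁′ = s^sh·(u₀′ s^{w₀−w₁−sh})`), `qs_sigmaR_u'_two_sub` (`σ_R u₂′ − u₂′ = s^sh·u₀′`);
* `qs_augmentationIdeal_le_and_residual` — (H1) `aug σ_R ≤ (s^sh)`, `u₀′ ∈ 𝔞`, `t̂ ∈ 𝔞`; iterates `qs_sigmaR_iterate_u'_one/two` (for the norm cover elements).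
-/

set_option linter.dupNamespace false

noncomputable section

open Literature.AlgebraicGeometry.Resolution
open scoped LaurentPolynomial
open Summit.ResolutionOfSingularities.ResolutionOfSingularities.Theorems.WildQuotientResolution.S1.CoarseChart
open Summit.ResolutionOfSingularities.ResolutionOfSingularities.Theorems.WildQuotientResolution.S1.GameFrame.GModel

namespace Summit.ResolutionOfSingularities.ResolutionOfSingularities.Theorems.WildQuotientResolution.S1.KillCert.QhSym

variable {L : Type} [CommRing L] (τ : L ≃+* L) (f : Fin 3 → L) (x₃ t : L) (w : Fin 3 → ℕ) (sh : ℕ) (Gfix : Set L)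
  (h0 : τ (f 0) = f 0) (h1 : τ (f 1) = f 1 + f 0) (h2 : τ (f 2) = f 2 + f 0) (h3 : τ x₃ = x₃ + t)
  (hfix : ∀ g ∈ Gfix, τ g = g) (hgen : Subring.closure (Set.range f ∪ {x₃} ∪ Gfix) = ⊤)
  (hw1 : w 1 + sh ≤ w 0) (hw2 : w 0 = w 2 + sh) (ht : t ∈ (weightedFiltration f w).ideal sh)

/-! ## (a′)_sh -/

include h0 h1 h2 h3 hfix hgen hw1 hw2 ht in
/-- **(a′)_sh for the root with two moving generators**, `β = 1` product form: `y ∈ 𝒥ₙ ⇒ τy − y ∈ (1)·𝒥ₙ₊sh` (rows `fⱼ ↦ f₀ ∈ 𝒥_{w₀} ≤ 𝒥_{wⱼ+sh}`, `x₃ ↦ t ∈ 𝒥_sh`).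
[OURS · L1 W4.5c · R4c brick (i)] -/
theorem qs_admissible_one :
    (∀ (n : ℕ) (y : L), y ∈ (weightedFiltration f w).ideal n → τ y - y ∈ Ideal.span {(1 : L)} * (weightedFiltration f w).ideal (n + sh)) ∧
      ∀ n : ℕ, ((weightedFiltration f w).ideal n).map (τ : L →+* L) ≤ (weightedFiltration f w).ideal n := by
  suffices hadm : ∀ (n : ℕ) (y : L), y ∈ (weightedFiltration f w).ideal n → τ y - y ∈ Ideal.span {(1 : L)} * (weightedFiltration f w).ideal (n + sh) from
    ⟨hadm, map_le_of_admissible_shift _ _ τ sh 1 hadm⟩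
  intro n y hy
  have hX0 : f 0 ∈ (weightedFiltration f w).ideal (w 0) := mem_weightedFiltration_ideal f w 0
  have h1J : ∀ {m : ℕ} {z : L}, z ∈ (weightedFiltration f w).ideal m → z ∈ Ideal.span {(1 : L)} * (weightedFiltration f w).ideal m :=
    fun hz => by rw [Ideal.span_singleton_one, Ideal.top_mul]; exact hz
  refine admissible_shift_of_generators f w τ sh 1 _ hgen ?_ ?_ n y hy
  · rintro g ((⟨i, rfl⟩ | hg) | hg)
    · refine h1J ?_
      fin_cases i
      · change τ (f 0) - f 0 ∈ _; rw [h0, sub_self]; exact Ideal.zero_mem _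
      · change τ (f 1) - f 1 ∈ _; rw [h1, add_sub_cancel_left]; exact (weightedFiltration _ _).antitone (by omega) hX0
      · change τ (f 2) - f 2 ∈ _; rw [h2, add_sub_cancel_left]; exact (weightedFiltration _ _).antitone (by omega) hX0
    · rw [Set.mem_singleton_iff.mp hg, h3, add_sub_cancel_left]; exact h1J ht
    · rw [hfix g hg, sub_self]; exact Ideal.zero_mem _
  · intro i
    refine h1J ?_
    fin_cases i
    · change τ (f 0) - f 0 ∈ _; rw [h0, sub_self]; exact Ideal.zero_mem _
    · change τ (f 1) - f 1 ∈ (weightedFiltration f w).ideal (w 1 + sh)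
      rw [h1, add_sub_cancel_left]; exact (weightedFiltration _ _).antitone hw1 hX0
    · change τ (f 2) - f 2 ∈ (weightedFiltration f w).ideal (w 2 + sh)
      rw [h2, add_sub_cancel_left, ← hw2]; exact hX0

/-! ## (H1), the rows in `R^w` and the residual ideal `𝔞 = (aug σ_R : s^sh)` -/

section Residual

variable {p : ℕ} (hp : 0 < p) (hσp : ∀ x : L, (⇑τ)^[p] x = x)
  (hσJ : ∀ n : ℕ, ((weightedFiltration f w).ideal n).map (τ : L →+* L) ≤ (weightedFiltration f w).ideal n)

/-- The shifted root element `u₀′·s^{w₀−m}` has Laurent form `C (f 0)·T^m` for `m ≤ w₀`. -/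
theorem coe_u'_zero_mul_s_pow {m : ℕ} (hm : m ≤ w 0) :
    ((cobordantAlgebra.u' f w 0 * cobordantAlgebra.s f w ^ (w 0 - m) : ↥(cobordantAlgebra f w)) : L[T;T⁻¹]) = LaurentPolynomial.C (f 0) * LaurentPolynomial.T ((m : ℕ) : ℤ) := by
  rw [MulMemClass.coe_mul, cobordantAlgebra.coe_u', cobordantAlgebra.coe_s_pow, mul_assoc, ← LaurentPolynomial.T_add]
  congr 2
  omega

include h1 hw1 in
/-- `σ_R u₁′ − u₁′ = s^sh · (u₀′·s^{w₀−w₁−sh})` (the lighter moving generator). -/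
theorem qs_sigmaR_u'_one_sub :
    sigmaR τ f w hσJ hp hσp (cobordantAlgebra.u' f w 1) - cobordantAlgebra.u' f w 1 =
      cobordantAlgebra.s f w ^ sh * (cobordantAlgebra.u' f w 0 * cobordantAlgebra.s f w ^ (w 0 - (w 1 + sh))) := by
  have hyj : τ (f 1) - f 1 = 1 * f 0 := by rw [h1]; ring
  have h := sigmaR_sub_eq_of_admissible_shift f w τ hσJ hp hσp sh 1 (n := w 1) hyj (cobordantAlgebra.u' f w 1)
    (cobordantAlgebra.u' f w 0 * cobordantAlgebra.s f w ^ (w 0 - (w 1 + sh))) (by rw [cobordantAlgebra.coe_u']) (coe_u'_zero_mul_s_pow f w hw1)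
  rw [h, map_one, one_mul]

include h2 hw2 in
/-- `σ_R u₂′ − u₂′ = s^sh · u₀′` (the heavier moving generator, `w₀ = w₂ + sh`). -/
theorem qs_sigmaR_u'_two_sub :
    sigmaR τ f w hσJ hp hσp (cobordantAlgebra.u' f w 2) - cobordantAlgebra.u' f w 2 = cobordantAlgebra.s f w ^ sh * cobordantAlgebra.u' f w 0 := by
  have hyj : τ (f 2) - f 2 = 1 * f 0 := by rw [h2]; ring
  have h := sigmaR_sub_eq_of_admissible_shift f w τ hσJ hp hσp sh 1 (n := w 2) hyj (cobordantAlgebra.u' f w 2) (cobordantAlgebra.u' f w 0)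
    (by rw [cobordantAlgebra.coe_u']) (by rw [cobordantAlgebra.coe_u', hw2])
  rw [h, map_one, one_mul]

include h0 h1 h2 h3 hfix hgen hw1 hw2 ht in
/-- ★ **(H1) and the residual memberships** for the root with two moving generators: `aug σ_R ≤ (s^sh)`, `u₀′ ∈ 𝔞 := (aug σ_R : s^sh)` (from the heavier
generator's row — the `[f 0]`-chart is KILLED) and `t̂ ∈ 𝔞`. [OURS · L1 W4.5c · R4c brick (i)] -/
theorem qs_augmentationIdeal_le_and_residual :
    augmentationIdeal (sigmaR τ f w hσJ hp hσp) ≤ Ideal.span {cobordantAlgebra.s f w ^ sh} ∧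
      cobordantAlgebra.u' f w 0 ∈ (augmentationIdeal (sigmaR τ f w hσJ hp hσp)).colon (Ideal.span {cobordantAlgebra.s f w ^ sh}) ∧
      (⟨_, C_mul_T_mem_cobordantAlgebra _ _ ht⟩ : ↥(cobordantAlgebra f w)) ∈ (augmentationIdeal (sigmaR τ f w hσJ hp hσp)).colon (Ideal.span {cobordantAlgebra.s f w ^ sh}) := by
  refine ⟨?_, ?_, QhAbs.qha_tail_mem_residual τ f x₃ t w sh h3 ht hp hσp hσJ⟩
  · have h := augmentationIdeal_sigmaR_le_span_of_admissible_shift f w τ hσJ hp hσp sh 1 (qs_admissible_one τ f x₃ t w sh Gfix h0 h1 h2 h3 hfix hgen hw1 hw2 ht).1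
    rwa [map_one, one_mul] at h
  · rw [Ideal.mem_colon_span_singleton, mul_comm, ← qs_sigmaR_u'_two_sub τ f w sh h2 hw2 hp hσp hσJ]
    exact sub_mem_augmentationIdeal _ _

/-! ## Iterates (norms of the moving generators) -/

include h0 h1 hw1 in
/-- The iterates of the lighter generator: `σ_Rˡ u₁′ = u₁′ + l·s^sh·(u₀′ s^{w₀−w₁−sh})`. -/
theorem qs_sigmaR_iterate_u'_one (l : ℕ) :
    (⇑(sigmaR τ f w hσJ hp hσp))^[l] (cobordantAlgebra.u' f w 1) =
      cobordantAlgebra.u' f w 1 + (l : ↥(cobordantAlgebra f w)) * (cobordantAlgebra.s f w ^ sh * (cobordantAlgebra.u' f w 0 * cobordantAlgebra.s f w ^ (w 0 - (w 1 + sh)))) := by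
  induction l with
  | zero => simp
  | succ l ih =>
    have hrow := qs_sigmaR_u'_one_sub τ f w sh h1 hw1 hp hσp hσJ
    rw [sub_eq_iff_eq_add] at hrow
    rw [Function.iterate_succ_apply', ih, map_add, map_mul, map_natCast, map_mul, map_mul, map_pow, map_pow, sigmaR_s, QhAbs.qha_sigmaR_u'_zero τ f w h0 hp hσp hσJ, hrow]
    push_cast
    ring

include h0 h2 hw2 in
/-- The iterates of the heavier generator: `σ_Rˡ u₂′ = u₂′ + l·s^sh·u₀′`. -/
theorem qs_sigmaR_iterate_u'_two (l : ℕ) :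
    (⇑(sigmaR τ f w hσJ hp hσp))^[l] (cobordantAlgebra.u' f w 2) =
      cobordantAlgebra.u' f w 2 + (l : ↥(cobordantAlgebra f w)) * (cobordantAlgebra.s f w ^ sh * cobordantAlgebra.u' f w 0) := by
  induction l with
  | zero => simp
  | succ l ih =>
    have hrow := qs_sigmaR_u'_two_sub τ f w sh h2 hw2 hp hσp hσJ
    rw [sub_eq_iff_eq_add] at hrow
    rw [Function.iterate_succ_apply', ih, map_add, map_mul, map_natCast, map_mul, map_pow, sigmaR_s, QhAbs.qha_sigmaR_u'_zero τ f w h0 hp hσp hσJ, hrow]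
    push_cast
    ring

end Residual

end Summit.ResolutionOfSingularities.ResolutionOfSingularities.Theorems.WildQuotientResolution.S1.KillCert.QhSym

end
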